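import Summits.BirchSwinnertonDyer.BirchSwinnertonDyer.Theorems.EisensteinPrimesMazurMCOnCellBTwistbackOnePartner
import Summits.BirchSwinnertonDyer.BirchSwinnertonDyer.Theorems.EisensteinPrimesBSDpOnCellCTwistCertificate
import HarnessLib

/-!
# Crux 3 `MazurMCOnCellB` (stmt-BirchSwinnertonDyer-19033), line `twistback` v5/v6 — ROAD (e) «TWO-STEP TWIST UNIT»
# into stub 6′ `stub_upperPartnerOffSubrow`, PER PAIR, BOTH signs at `p` (split INCLUDED), every odd `p`:
# the ∃-PARTNER clause at `(W, p)` and Mazur's main conjecture at `(W, p)` from the cone's named facts, Wuthrich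
# 2014 Prop. 21, two admissible fields and ONE exact rational certificate `ord_p #Ш_an(W″) = 0` two twists away

Width seat bsd-line-x2-p1-w6 (gen 2), cell `bsd-eis`, 2026-08-28; `--supports stmt-BirchSwinnertonDyer-19033 --as helper`.
HONEST FRAMING: conditional theorems only; no `def`, no named fact introduced, no `sorry`; closes no registered stub; no summit
statement, no Mazur main conjecture and no BSD is proved for any curve unconditionally; 0 cells / labels / stubs / tiers move.

## The road

At an X2b pair `(W, p)` take an ADMISSIBLE `K` (imaginary quadratic, `d_K` odd `< −4`, Heegner for `N_W` and for `p`) with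
`ord_{s=1} L(E^{(d_K)}, s) = 1`; a globally minimal model `Wd` of the PARTNER `E^{(d_K)}` is an X2c pair at `p`
(`X2.classX2_twist`). Take a SECOND admissible field `K″` FOR `Wd` (Heegner for `N_{Wd}` and for `p`, `d_{K″}` odd `< −4`)
with `L(Wd^{(d_{K″})}, 1) ≠ 0` and a globally minimal model `W″` of `Wd^{(d_{K″})}` — a rank-ZERO X2 curve two quadratic
twists away from `W` (X2b-type again: the parity flips twice) — with ONE exact rational certificate `ord_p #Ш_an(W″) = 0`.

* §1 `bsdp_partner_of_twoStepShaUnit` / `missingUpperBoundAt_partner_of_twoStepShaUnit`: `BSDp Wd p`, hence the UPPER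
  (Euler-system) half `Typed.MissingUpperBoundAt Wd p` — crux 4's TWIST-CERTIFICATE door
  `Reoriented.bsdp_of_cellC_of_twistShaUnit` (seat cgshw g15, p517406: Wuthrich 2014 Prop. 21 closes `BSD_p(W″)`;
  re-oriented anticyclotomic IMC atoms from Keller–Yin Thm. D BY NAME; BDP value atom from the REFEREED Liu–Zhang–Zhang
  fact; optimal-curve / Manin / Cassels transports inside) read at the X2c pair `(Wd, p)`.
* §2 `upperPartner_at_of_twoStepShaUnit`: **the ∃-PARTNER clause of `stub_upperPartnerOffSubrow` AT `(W, p)` VERBATIM**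
  (every globally minimal model of `E^{(d_K)}`: Cassels transport `X2.bsdp_of_isIsogenous_of_bsdp`, `isIsogenous_of_smul_eq`).
* §3 `bsdp_of_cellB_of_twoStepShaUnit` / `mazurMainConjectureAt_of_cellB_of_twoStepShaUnit`: PER PAIR `BSD(E,p)` and
  Mazur's main conjecture at `(W, p)`, the `(W, K)` half run EXACTLY as in LEAD g9's p640326 §1 (there class-wide):
  optimal curve `W₀ ∼ W` with a datum prime to `p` (`X2.exists_isIsogenous_hasPrimeToManinDatum`), `N_{W₀} = N_W`
  (`conductorNorm_eq_of_isIsogenous_of_modularity_of_isGloballyMinimal`), `E^{(d)} ∼ E₀^{(d)}` (`IsIsogenous.quadraticTwist`),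
  Heegner datum and point (`exists_dvd_sq_sub_discr_holds`, `nonempty_heegnerDatum_holds`, Darmon Thm. 3.6), STEP L in the
  rank-zero orientation from item -27489 (`indexLowerBoundRankZero_of_kRankOne`) ⟸ Keller–Yin Thm. D + Poitou–Tate ×2 +
  Hsieh + LZZ (`heegnerIndexIdentityKRankOne_of_thmD_OPEN_of_thm151_thm153`), LEAD g7's per-pair lower half p625263 §2
  (`mazurMainConjectureAt_of_indexLowerBoundAt_of_upper_twist`), Cassels back, `X2.mazurMainConjectureAt_of_bsdp_of_red`.

HYPOTHESES BY NAME (nothing asserted): `PublishedInputs` (stmt-…-19037), Poitou–Tate ×2, Hsieh 2014 Thm. 1, Liu–Zhang–Zhang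
2018, Mazur 1978 Cor. 4.1 (PUBLISHED / refereed; conjuncts of stubs 1–2), Keller–Yin 2024 Thm. D (stub 3a; UNREFEREED
PREPRINT), Wuthrich 2014 Prop. 21 `sha_dvd_analyticSha` (PUBLISHED; NOT a `PublishedInputs` conjunct — `anchor`'s
`stub_wuthrichProp21`). PER PAIR: `K`, `K″`, `Wd`, `W″`, the readings `ord_{s=1} L(E^{(d_K)},s) = 1`, `L(Wd^{(d_{K″})},1) ≠ 0`,
two Heegner hypotheses, ONE exact rational `#Ш_an(W″)` with `ord_p = 0`. NO `p`-adic `L`-function, NO height / Schneider,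
NO exceptional leading term, NO line datum / class number / Greenberg–Vatsal (3.11) / Disegni.

## Why (census bearing; numbers are the cited seats', not mine)

LEAD g12/g13 (verdict-g12 §2): the open stub 6′ splits as (i) SPLIT pairs, 83/127 A10 cells — road (c) `(0,2)` +
`X2.O9.ExceptionalLeadingTermAt`, OPEN in print for reducible `E[p]` even per pair; (ii) non-split `c(E) ≠ 1`, 14/127 —
road (b), a per-pair `3`-adic certificate (kit); (iii) `p ≠ 3`. Road (e) is SIGN-FREE at `p`, so on the 83 SPLIT cells it is
the only per-pair road inside the line resting on print + one PRE fact, with an exact RATIONAL certificate. Witnesses (idea-12 g8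
`Cruxes/MazurMCOnCellB/ANCHOR-CENSUS-g8.md`): unit rank-zero ends for 19/19 computed X2b classes `N ≤ 900` (all split at
`3`; rev 3: 46/46, `|d_K d_{K″}| ≤ 8·10⁴`) and at distance one for 42/42 X2c ∩ GV classes `N ≤ 4132`. CLASS-WIDE the
supply is OPEN (idea-12 `twistunit` `HeegnerUnitTwist` / `anchor` `UnitAnchorSupply`; LEAD g9: off the Cassels-consistent
box it is impossible modulo BSD) — this file asks the unit only where it is read and claims nothing class-wide.

PRIOR ART (delta): LEAD g7 `…TwistbackUnitLever` §2 (p627870) = the same mechanism with STEP L, co-STEP L and BOTH Heegner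
data as hypotheses, concluding MC only; idea-12's `Lines/twistunit.lean` / `Lines/anchor.lean` are Cruxes workfiles (class-wide
∃-supply stubs); crux 4's door concludes `BSDp` at an X2c pair. Here those inputs are DISCHARGED and §2 is the stub's clause.

References: [CastellaEtAl2021] Thm. 5.3.1; [JetchevSkinnerWan2017] §7.4.1; [KellerYin2024] Thm. D (PRE); [LiuZhangZhang2018];
[Hsieh2014] Thm. 1; [Wuthrich2014] Thm. 16, Prop. 21; [Mazur1978] Cor. 4.1; [Darmon2004] Thm. 3.6; [Miller2011LMS] Def. 1.1.
-/

set_option autoImplicit false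
-- `Summit.BirchSwinnertonDyer.BirchSwinnertonDyer.…`: the summit and its single sub-problem share a name.
set_option linter.dupNamespace false

noncomputable section

open scoped Classical MatrixGroups ModularForm

open CongruenceSubgroup WeierstrassCurve NumberField
  Literature.NumberTheory.EllipticCurves
  Literature.NumberTheory.EllipticCurves.ModularForms
  Literature.NumberTheory.QuadraticFields
  Literature.NumberTheory.EllipticCurves.Rank1Residual
  Literature.NumberTheory.EllipticCurves.Rank1Residual.Typed
  Literature.NumberTheory.EllipticCurves.Wuthrich2014
  Literature.NumberTheory.EllipticCurves.SteinWuthrich2013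
  Literature.NumberTheory.EllipticCurves.GreenbergVatsal2000
  Literature.NumberTheory.EllipticCurves.KellerYin2024
  Literature.NumberTheory.GaloisCohomology
  Summit.BirchSwinnertonDyer.Rank1Residual
  Summit.BirchSwinnertonDyer.BirchSwinnertonDyer.Theses
  Summit.BirchSwinnertonDyer.BirchSwinnertonDyer.Theorems.EisensteinPrimesMazurMCOnCellBTwistbackLowerHalf
  Summit.BirchSwinnertonDyer.BirchSwinnertonDyer.Theorems.EisensteinPrimesMazurMCOnCellBTwistbackLowerHalfByName
  Summit.BirchSwinnertonDyer.BirchSwinnertonDyer.Theorems.EisensteinPrimesMazurMCOnCellBTwistbackValueOfLZZByName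

namespace Summit.BirchSwinnertonDyer.BirchSwinnertonDyer.Theorems.EisensteinPrimesMazurMCOnCellBTwistbackTwoStepShaUnit

/-! ## §1. The partner's `BSD(p)` and its upper half from the second step -/

/-- **The rank-one PARTNER is closed by a unit twist one more step away.** Data: `(W, p)` an X2 pair (`p ≠ 2`, `E[p]`
reducible, `p` multiplicative; NO rank or parity hypothesis on `W`); `K` imaginary quadratic with `p` split; `Wd` a
globally minimal model of `E^{(d_K)}` with `ord_{s=1} L(Wd, s) = 1` (so `(Wd, p)` is an X2c pair, `X2.classX2_twist`);
`K″` admissible FOR `Wd` (imaginary quadratic, `d_{K″}` odd `< −4`, Heegner for `N_{Wd}` and for `p`) with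
`L(Wd^{(d_{K″})}, 1) ≠ 0`; `W″` a globally minimal model of `Wd^{(d_{K″})}` with `#Ш_an(W″)` a rational `p`-unit. Named
facts BY NAME: `PublishedInputs` (newforms, Gross–Zagier, Kolyvagin, GZK, Cassels are the conjuncts used), Wuthrich 2014
Prop. 21, Poitou–Tate ×2, Hsieh 2014 Thm. 1, Liu–Zhang–Zhang 2018, Mazur 1978 Cor. 4.1, Keller–Yin Thm. D (PRE).
Conclusion: `BSDp Wd p`. Proof: crux 4's twist-certificate door `Reoriented.bsdp_of_cellC_of_twistShaUnit` at `(Wd, p)`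
with its value atom from LZZ (`X2.bdpValueContinuousDisplayAt_of_lzzRoadInputIoo ∘ X2.lzzRoadInputIoo_of_thm151_thm153`)
and its IMC atoms from Thm. D (`X2.forall_{nonsplit,split}IMCEqOnTreeIntOther_of_thmD_OPEN`). CONDITIONAL on every
listed binder. [claim: KellerYin2024, status: under-review] [cite: KellerYin2024, Thm. D = Thm. 5.1.3 (arXiv:2402.12781v2 L306–L309)]
[cite: Wuthrich2014, Prop. 21 (p. 400)] [cite: LiuZhangZhang2018, Thms. 1.5.1 and 1.5.3 (Duke 167 pp. 748–749)]
[cite: CastellaEtAl2021, Thm. 5.3.1 and (5.5)–(5.7)] [cite: Hsieh2014, Thm. 1] [cite: Mazur1978, Cor. 4.1] [cite: Miller2011LMS, Def. 1.1] -/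
theorem bsdp_partner_of_twoStepShaUnit (hP : EisensteinPrimes.PublishedInputs) (hW21 : sha_dvd_analyticSha)
    (hPT : ∀ (K : Type) [Field K] [NumberField K], poitouTate_selmerStructure_duality K)
    (hPT2 : ∀ (K : Type) [Field K] [NumberField K], poitouTate_sha_tateDual K)
    (hH : hsieh2014_exists_anticyclotomicPAdicLFunction)
    (hF : LiuZhangZhang2018.thm151_thm153_modularCurve_heegnerVector) (hMaz : mazur_not_dvd_maninConstant_of_odd)
    (hD : KellerYin2024.thmD_imcMult_exists_isBDPLFunction_isTorsion_charIdeal_eq_OPEN)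
    (W : WeierstrassCurve ℚ) [W.IsElliptic] [W.IsGloballyMinimal] (p : ℕ) [Fact p.Prime] (hX : ClassX2 W p)
    (K : Type) [Field K] [NumberField K] (hK : IsImaginaryQuadratic K) (hHp : SatisfiesHeegnerHypothesis p K)
    (Wd : WeierstrassCurve ℚ) [Wd.IsElliptic] [Wd.IsGloballyMinimal]
    (hWd : ∃ C : VariableChange ℚ, C • Wd = W.quadraticTwist (NumberField.discr K : ℚ))
    (hrd : Wd.analyticRank = 1)
    (K'' : Type) [Field K''] [NumberField K''] (hK'' : IsImaginaryQuadratic K'')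
    (hodd'' : Odd (NumberField.discr K'')) (hlt'' : NumberField.discr K'' < -4)
    (hHN'' : SatisfiesHeegnerHypothesis (Wd.conductorNorm ℤ) K'') (hHp'' : SatisfiesHeegnerHypothesis p K'')
    (hL'' : (Wd.quadraticTwist (NumberField.discr K'' : ℚ)).entireLFunction 1 ≠ 0)
    (W'' : WeierstrassCurve ℚ) [W''.IsElliptic] [W''.IsGloballyMinimal]
    (hW'' : ∃ C : VariableChange ℚ, C • W'' = Wd.quadraticTwist (NumberField.discr K'' : ℚ))
    (hunit : ∃ q : ℚ, shaAn W'' = (q : ℂ) ∧ padicValRat p q = 0) : BSDp Wd p := by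
  have hCassels := hP.2.1
  have hnf := hP.2.2.2.2.2.1
  have hGZ := hP.2.2.2.2.2.2.2.2.1
  have hKo := hP.2.2.2.2.2.2.2.2.2.1
  have hGZK := hP.2.2.2.2.2.2.2.2.2.2.1
  have hcd : X2.CellC Wd p := ⟨hrd, X2.classX2_twist W p hX K hK hHp Wd hWd⟩
  exact Reoriented.bsdp_of_cellC_of_twistShaUnit Wd p hW21 hnf hPT hPT2 hH hGZ hKo hGZK hMaz hCassels
    (fun W' _ _ _ ↦ X2.bdpValueContinuousDisplayAt_of_lzzRoadInputIoo (X2.lzzRoadInputIoo_of_thm151_thm153 hF) W' p)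
    (fun W' _ _ hc' hns ↦ X2.forall_nonsplitIMCEqOnTreeIntOther_of_thmD_OPEN hD W' p hc' hns)
    (fun W' _ _ hc' hs ↦ X2.forall_splitIMCEqOnTreeIntOther_of_thmD_OPEN hD W' p hc' hs)
    hcd K'' hK'' hodd'' hlt'' hHN'' hHp'' hL'' W'' hW'' hunit

/-- **The UPPER (Euler-system) half `Typed.MissingUpperBoundAt Wd p` at the rank-one partner** (the per-pair input `hUd` of
`…TwistbackLowerHalf` §2 = stub 6′'s last clause) from §1: `BSDp ⟹ MissingPPartAt ⟹ both halves`, `Ш(Wd)` finite by GZK.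
CONDITIONAL. [claim: KellerYin2024, status: under-review] [cite: Wuthrich2014, Prop. 21 (p. 400)] [cite: Miller2011LMS, Def. 1.1] -/
theorem missingUpperBoundAt_partner_of_twoStepShaUnit (hP : EisensteinPrimes.PublishedInputs) (hW21 : sha_dvd_analyticSha)
    (hPT : ∀ (K : Type) [Field K] [NumberField K], poitouTate_selmerStructure_duality K)
    (hPT2 : ∀ (K : Type) [Field K] [NumberField K], poitouTate_sha_tateDual K)
    (hH : hsieh2014_exists_anticyclotomicPAdicLFunction)
    (hF : LiuZhangZhang2018.thm151_thm153_modularCurve_heegnerVector) (hMaz : mazur_not_dvd_maninConstant_of_odd)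
    (hD : KellerYin2024.thmD_imcMult_exists_isBDPLFunction_isTorsion_charIdeal_eq_OPEN)
    (W : WeierstrassCurve ℚ) [W.IsElliptic] [W.IsGloballyMinimal] (p : ℕ) [Fact p.Prime] (hX : ClassX2 W p)
    (K : Type) [Field K] [NumberField K] (hK : IsImaginaryQuadratic K) (hHp : SatisfiesHeegnerHypothesis p K)
    (Wd : WeierstrassCurve ℚ) [Wd.IsElliptic] [Wd.IsGloballyMinimal]
    (hWd : ∃ C : VariableChange ℚ, C • Wd = W.quadraticTwist (NumberField.discr K : ℚ))
    (hrd : Wd.analyticRank = 1)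
    (K'' : Type) [Field K''] [NumberField K''] (hK'' : IsImaginaryQuadratic K'')
    (hodd'' : Odd (NumberField.discr K'')) (hlt'' : NumberField.discr K'' < -4)
    (hHN'' : SatisfiesHeegnerHypothesis (Wd.conductorNorm ℤ) K'') (hHp'' : SatisfiesHeegnerHypothesis p K'')
    (hL'' : (Wd.quadraticTwist (NumberField.discr K'' : ℚ)).entireLFunction 1 ≠ 0)
    (W'' : WeierstrassCurve ℚ) [W''.IsElliptic] [W''.IsGloballyMinimal]
    (hW'' : ∃ C : VariableChange ℚ, C • W'' = Wd.quadraticTwist (NumberField.discr K'' : ℚ))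
    (hunit : ∃ q : ℚ, shaAn W'' = (q : ℂ) ∧ padicValRat p q = 0) : MissingUpperBoundAt Wd p := by
  have hGZK := hP.2.2.2.2.2.2.2.2.2.2.1
  have hbsd : BSDp Wd p :=
    bsdp_partner_of_twoStepShaUnit hP hW21 hPT hPT2 hH hF hMaz hD W p hX K hK hHp Wd hWd hrd K'' hK'' hodd''
      hlt'' hHN'' hHp'' hL'' W'' hW'' hunit
  haveI : Finite Wd.sha := (hGZK Wd (le_of_eq hrd)).2
  exact (lower_and_upper_of_missingPPartAt Wd p (missingPPartAt_of_bsdp Wd p hbsd)).2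

/-! ## §2. The ∃-PARTNER clause of `stub_upperPartnerOffSubrow` AT `(W, p)` -/

/-- **Stub 6′ (∃-PARTNER) AT `(W, p)` from a TWO-STEP UNIT datum — both signs at `p`, every odd `p`.** Data: an
X2b pair `(W, p)`; `K` admissible for `W` (imaginary quadratic, Heegner for `N_W` and for `p`, `d_K` odd `< −4`) with
`ord_{s=1} L(E^{(d_K)}, s) = 1`; ONE globally minimal model `Wd` of `E^{(d_K)}`; `K″` admissible for `Wd` with
`L(Wd^{(d_{K″})},1) ≠ 0`; `W″` a globally minimal model of `Wd^{(d_{K″})}` with `ord_p #Ш_an(W″) = 0`. Conclusion: the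
partner clause of `stub_upperPartnerOffSubrow` at `(W, p)` VERBATIM (witness `K`; the upper half at EVERY globally
minimal model `Wd′` of the twist by Cassels transport `X2.bsdp_of_isIsogenous_of_bsdp` along `Wd ≅ E^{(d_K)} ≅ Wd′`).
Same named facts as §1. CONDITIONAL; nothing about any curve is proved unconditionally; the existence of such
`(K, K″)` for every X2b pair is an OPEN supply statement (idea-12 `twistunit` / `anchor`), not claimed here.
[claim: KellerYin2024, status: under-review] [cite: KellerYin2024, Thm. D = Thm. 5.1.3 (arXiv:2402.12781v2 L306–L309)]
[cite: Wuthrich2014, Prop. 21 (p. 400)] [cite: MilneADT2006, Thm. I.7.3 (Cassels)] [cite: Miller2011LMS, Def. 1.1] -/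
theorem upperPartner_at_of_twoStepShaUnit (hP : EisensteinPrimes.PublishedInputs) (hW21 : sha_dvd_analyticSha)
    (hPT : ∀ (K : Type) [Field K] [NumberField K], poitouTate_selmerStructure_duality K)
    (hPT2 : ∀ (K : Type) [Field K] [NumberField K], poitouTate_sha_tateDual K)
    (hH : hsieh2014_exists_anticyclotomicPAdicLFunction)
    (hF : LiuZhangZhang2018.thm151_thm153_modularCurve_heegnerVector) (hMaz : mazur_not_dvd_maninConstant_of_odd)
    (hD : KellerYin2024.thmD_imcMult_exists_isBDPLFunction_isTorsion_charIdeal_eq_OPEN)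
    (W : WeierstrassCurve ℚ) [W.IsElliptic] [W.IsGloballyMinimal] (p : ℕ) [Fact p.Prime] (hc : X2.CellB W p)
    (K : Type) [Field K] [NumberField K] (hK : IsImaginaryQuadratic K)
    (hHN : SatisfiesHeegnerHypothesis (W.conductorNorm ℤ) K) (hHp : SatisfiesHeegnerHypothesis p K)
    (hoddK : Odd (NumberField.discr K)) (hlt : NumberField.discr K < -4)
    (hr1 : (W.quadraticTwist (NumberField.discr K : ℚ)).analyticRank = 1)
    (Wd : WeierstrassCurve ℚ) [Wd.IsElliptic] [Wd.IsGloballyMinimal]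
    (hWd : ∃ C : VariableChange ℚ, C • Wd = W.quadraticTwist (NumberField.discr K : ℚ))
    (K'' : Type) [Field K''] [NumberField K''] (hK'' : IsImaginaryQuadratic K'')
    (hodd'' : Odd (NumberField.discr K'')) (hlt'' : NumberField.discr K'' < -4)
    (hHN'' : SatisfiesHeegnerHypothesis (Wd.conductorNorm ℤ) K'') (hHp'' : SatisfiesHeegnerHypothesis p K'')
    (hL'' : (Wd.quadraticTwist (NumberField.discr K'' : ℚ)).entireLFunction 1 ≠ 0)
    (W'' : WeierstrassCurve ℚ) [W''.IsElliptic] [W''.IsGloballyMinimal]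
    (hW'' : ∃ C : VariableChange ℚ, C • W'' = Wd.quadraticTwist (NumberField.discr K'' : ℚ))
    (hunit : ∃ q : ℚ, shaAn W'' = (q : ℂ) ∧ padicValRat p q = 0) :
    ∃ (K : Type) (_ : Field K) (_ : NumberField K), IsImaginaryQuadratic K ∧
      SatisfiesHeegnerHypothesis (W.conductorNorm ℤ) K ∧ SatisfiesHeegnerHypothesis p K ∧
      Odd (NumberField.discr K) ∧ NumberField.discr K < -4 ∧
      (W.quadraticTwist (NumberField.discr K : ℚ)).analyticRank = 1 ∧
      ∀ (Wd : WeierstrassCurve ℚ) [Wd.IsElliptic] [Wd.IsGloballyMinimal],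
        (∃ C : VariableChange ℚ, C • Wd = W.quadraticTwist (NumberField.discr K : ℚ)) →
        MissingUpperBoundAt Wd p := by
  have hCassels := hP.2.1
  have hnf := hP.2.2.2.2.2.1
  have hGZK := hP.2.2.2.2.2.2.2.2.2.2.1
  have hE : WeierstrassCurve.hasEntireLFunction_rat :=
    WeierstrassCurve.hasEntireLFunction_rat_of_exists_isNewformOf hnf
  obtain ⟨C, hC⟩ := hWd
  have hrd : Wd.analyticRank = 1 := by
    have h := congrArg WeierstrassCurve.analyticRank hC
    rw [analyticRank_smul] at h
    exact h.trans hr1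
  have hbsd : BSDp Wd p :=
    bsdp_partner_of_twoStepShaUnit hP hW21 hPT hPT2 hH hF hMaz hD W p hc.2.1 K hK hHp Wd ⟨C, hC⟩ hrd K'' hK''
      hodd'' hlt'' hHN'' hHp'' hL'' W'' hW'' hunit
  refine ⟨K, inferInstance, inferInstance, hK, hHN, hHp, hoddK, hlt, hr1, fun Wd' _ _ hWd' ↦ ?_⟩
  obtain ⟨C', hC'⟩ := hWd'
  have hrd' : Wd'.analyticRank = 1 := by
    have h := congrArg WeierstrassCurve.analyticRank hC'
    rw [analyticRank_smul] at h
    exact h.trans hr1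
  have hiso : IsIsogenous Wd Wd' := (isIsogenous_of_smul_eq hC).trans' (isIsogenous_of_smul_eq' hC')
  have hbsd' : BSDp Wd' p :=
    X2.bsdp_of_isIsogenous_of_bsdp hCassels hGZK hE Wd Wd' hiso p (le_of_eq hrd) hbsd
  haveI : Finite Wd'.sha := (hGZK Wd' (le_of_eq hrd')).2
  exact (lower_and_upper_of_missingPPartAt Wd' p (missingPPartAt_of_bsdp Wd' p hbsd')).2

/-! ## §3. PER PAIR: `BSD(E,p)` and Mazur's main conjecture at `(W, p)` -/

/-- **PER PAIR: `BSD(E,p)` at an X2b pair from a TWO-STEP UNIT datum, with every Heegner datum DISCHARGED.** Data as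
in §2. Proof = LEAD g9's p640326 §1 at ONE pair: optimal curve `W₀ ∼ W` with a parametrisation datum `Dt` of level
`N_{W₀}` with `p ∤ c(Dt)` (`X2.exists_isIsogenous_hasPrimeToManinDatum`: Mazur Cor. 4.1, Edixhoven, modularity),
`X2.CellB W₀ p` (isogeny-class property, Tate facts discharged), `N_{W₀} = N_W` so `K` is admissible for `W₀`
(`conductorNorm_eq_of_isIsogenous_of_modularity_of_isGloballyMinimal`), `ord_{s=1} L(E₀^{(d_K)},s) = 1`
(`IsIsogenous.quadraticTwist`, `analyticRank_eq_of_isIsogenous'`), a Heegner datum `H` and point `P ∈ E₀(K)`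
(`exists_dvd_sq_sub_discr_holds`, `nonempty_heegnerDatum_holds`, Darmon Thm. 3.6), a globally minimal model `Wd₀` of
`E₀^{(d_K)}` whose upper half comes from §1 at `Wd` by Cassels (`Wd ∼ E^{(d)} ∼ E₀^{(d)} ∼ Wd₀`), STEP L in the rank-zero
orientation from item -27489 ⟸ Keller–Yin Thm. D + Poitou–Tate ×2 + Hsieh + LZZ
(`indexLowerBoundRankZero_of_kRankOne ∘ heegnerIndexIdentityKRankOne_of_thmD_OPEN_of_thm151_thm153`), LEAD g7's per-pair
lower half p625263 §2, `BSDp W₀ p`, Cassels to `W`. CONDITIONAL; nothing about any curve is proved unconditionally.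
[claim: KellerYin2024, status: under-review] [cite: KellerYin2024, Thm. D = Thm. 5.1.3 (arXiv:2402.12781v2 L306–L309)]
[cite: JetchevSkinnerWan2017, §7.4.1 (eq:shalowerK-1)] [cite: Wuthrich2014, Thm. 16 (p. 397) and Prop. 21 (p. 400)]
[cite: Mazur1978, Cor. 4.1] [cite: Darmon2004, Thm. 3.6] [cite: MilneADT2006, Thm. I.7.3] [cite: Miller2011LMS, Def. 1.1] -/
theorem bsdp_of_cellB_of_twoStepShaUnit (hP : EisensteinPrimes.PublishedInputs) (hW21 : sha_dvd_analyticSha)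
    (hPT : ∀ (K : Type) [Field K] [NumberField K], poitouTate_selmerStructure_duality K)
    (hPT2 : ∀ (K : Type) [Field K] [NumberField K], poitouTate_sha_tateDual K)
    (hH : hsieh2014_exists_anticyclotomicPAdicLFunction)
    (hF : LiuZhangZhang2018.thm151_thm153_modularCurve_heegnerVector) (hMaz : mazur_not_dvd_maninConstant_of_odd)
    (hD : KellerYin2024.thmD_imcMult_exists_isBDPLFunction_isTorsion_charIdeal_eq_OPEN)
    (W : WeierstrassCurve ℚ) [W.IsElliptic] [W.IsGloballyMinimal] (p : ℕ) [Fact p.Prime] (hc : X2.CellB W p)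
    (K : Type) [Field K] [NumberField K] (hK : IsImaginaryQuadratic K)
    (hHN : SatisfiesHeegnerHypothesis (W.conductorNorm ℤ) K) (hHp : SatisfiesHeegnerHypothesis p K)
    (hoddK : Odd (NumberField.discr K)) (hlt : NumberField.discr K < -4)
    (hr1 : (W.quadraticTwist (NumberField.discr K : ℚ)).analyticRank = 1)
    (Wd : WeierstrassCurve ℚ) [Wd.IsElliptic] [Wd.IsGloballyMinimal]
    (hWd : ∃ C : VariableChange ℚ, C • Wd = W.quadraticTwist (NumberField.discr K : ℚ))
    (K'' : Type) [Field K''] [NumberField K''] (hK'' : IsImaginaryQuadratic K'')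
    (hodd'' : Odd (NumberField.discr K'')) (hlt'' : NumberField.discr K'' < -4)
    (hHN'' : SatisfiesHeegnerHypothesis (Wd.conductorNorm ℤ) K'') (hHp'' : SatisfiesHeegnerHypothesis p K'')
    (hL'' : (Wd.quadraticTwist (NumberField.discr K'' : ℚ)).entireLFunction 1 ≠ 0)
    (W'' : WeierstrassCurve ℚ) [W''.IsElliptic] [W''.IsGloballyMinimal]
    (hW'' : ∃ C : VariableChange ℚ, C • W'' = Wd.quadraticTwist (NumberField.discr K'' : ℚ))
    (hunit : ∃ q : ℚ, shaAn W'' = (q : ℂ) ∧ padicValRat p q = 0) : BSDp W p := by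
  have hCassels := hP.2.1
  have hpar := hP.2.2.2.2.1
  have hnf := hP.2.2.2.2.2.1
  have hGZ := hP.2.2.2.2.2.2.2.2.1
  have hKo := hP.2.2.2.2.2.2.2.2.2.1
  have hGZK := hP.2.2.2.2.2.2.2.2.2.2.1
  have hWu := hP.2.2.2.2.2.2.2.2.2.2.2.2.2.2.1
  have hJs := hP.2.2.2.2.2.2.2.2.2.2.2.2.2.2.2.1
  have hJn := hP.2.2.2.2.2.2.2.2.2.2.2.2.2.2.2.2.1
  have hHs := hP.2.2.2.2.2.2.2.2.2.2.2.2.2.2.2.2.2.1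
  have hHn := hP.2.2.2.2.2.2.2.2.2.2.2.2.2.2.2.2.2.2.1
  have hGS := hP.2.2.2.2.2.2.2.2.2.2.2.2.2.2.2.2.2.2.2
  have hE : WeierstrassCurve.hasEntireLFunction_rat :=
    WeierstrassCurve.hasEntireLFunction_rat_of_exists_isNewformOf hnf
  have hHP : ∀ (N : ℕ) [NeZero N] (W : WeierstrassCurve ℚ) (K : Type) [Field K] [NumberField K],
      heegnerPointComplex_mem_range_map N W K :=
    fun N _ W K _ _ ↦ heegnerPointComplex_mem_range_map_holds N W K
  have hEd : edixhoven_optimalManinConstant_integral :=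
    ModularForms.edixhoven_optimalManinConstant_integral_holds
  -- STEP L in the rank-zero orientation: item -27489 from Thm. D (+ PT ×2, Hsieh, LZZ)
  have hSL0 := indexLowerBoundRankZero_of_kRankOne
    (heegnerIndexIdentityKRankOne_of_thmD_OPEN_of_thm151_thm153 hP hPT hPT2 hH hF hD)
  have hpP : p.Prime := Fact.out
  have hp2 : p ≠ 2 := hc.2.1.1
  have hred : ¬ W.HasIrreducibleModPGaloisRep p := hc.2.1.2.1
  have hmult : W.HasMultiplicativeReductionAtPrime p := hc.2.1.2.2
  have hr : W.analyticRank = 0 := hc.1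
  ---------------------------------------------------------------- the partner at `Wd` (§1)
  obtain ⟨C, hC⟩ := hWd
  have hd0 : (NumberField.discr K : ℚ) ≠ 0 := by exact_mod_cast NumberField.discr_ne_zero K
  haveI := W.isElliptic_quadraticTwist hd0
  have hrd : Wd.analyticRank = 1 := by
    have h := congrArg WeierstrassCurve.analyticRank hC
    rw [analyticRank_smul] at h
    exact h.trans hr1
  have hbsd : BSDp Wd p :=
    bsdp_partner_of_twoStepShaUnit hP hW21 hPT hPT2 hH hF hMaz hD W p hc.2.1 K hK hHp Wd ⟨C, hC⟩ hrd K'' hK''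
      hodd'' hlt'' hHN'' hHp'' hL'' W'' hW'' hunit
  ---------------------------------------------------------------- the optimal curve `W₀ ∼ W` with `p ∤ c`
  obtain ⟨W₀, hE₀, hM₀, hiso, hMan⟩ :=
    X2.exists_isIsogenous_hasPrimeToManinDatum hEd hMaz hpar hnf W p hp2 hmult
  haveI := hE₀
  haveI := hM₀
  have hc₀ : X2.CellB W₀ p :=
    (X2.cellB_iff_of_isIsogenous (p := p) TateCurve.Silverman1994_thmV53_tateUniformisation_holds
      TateCurve.Silverman1994_thmV53_corV54_tateUniformisation_holds hiso).mp hc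
  have hr₀ : W₀.analyticRank = 0 := hc₀.1
  have hred₀ : ¬ W₀.HasIrreducibleModPGaloisRep p := hc₀.2.1.2.1
  have hmult₀ : W₀.HasMultiplicativeReductionAtPrime p := hc₀.2.1.2.2
  haveI : NeZero (W₀.conductorNorm ℤ) := ⟨(W₀.conductorNorm_pos_holds).ne'⟩
  obtain ⟨Dt, hcM⟩ := hMan
  ---------------------------------------------------------------- `K` is admissible for `W₀`
  have hN : W.conductorNorm ℤ = W₀.conductorNorm ℤ :=
    conductorNorm_eq_of_isIsogenous_of_modularity_of_isGloballyMinimal hpar hiso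
  have hHN₀ : SatisfiesHeegnerHypothesis (W₀.conductorNorm ℤ) K := hN ▸ hHN
  haveI := W₀.isElliptic_quadraticTwist hd0
  have hisoT : IsIsogenous (W.quadraticTwist (NumberField.discr K : ℚ))
      (W₀.quadraticTwist (NumberField.discr K : ℚ)) := hiso.quadraticTwist hd0
  have h1₀ : (W₀.quadraticTwist (NumberField.discr K : ℚ)).analyticRank = 1 := by
    rw [← analyticRank_eq_of_isIsogenous' hisoT]; exact hr1
  ---------------------------------------------------------------- the Heegner datum and its point
  obtain ⟨β, hβ⟩ := exists_dvd_sq_sub_discr_holds (W₀.conductorNorm ℤ) K hK hHN₀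
  obtain ⟨H, -⟩ := nonempty_heegnerDatum_holds (W₀.conductorNorm ℤ) K hK hβ
  obtain ⟨ι⟩ : Nonempty (K →+* ℂ) := inferInstance
  obtain ⟨P, hPt⟩ := hHP (W₀.conductorNorm ℤ) W₀ K hK hHN₀ Dt H ι
  ---------------------------------------------------------------- a minimal model of `E₀^{(d_K)}`; its upper half
  obtain ⟨Wd₀, _, _, C₀, hC₀⟩ := exists_isGloballyMinimal_smul_eq_quadraticTwist W₀ hd0
  have hrd₀ : Wd₀.analyticRank = 1 := by
    have h := congrArg WeierstrassCurve.analyticRank hC₀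
    rw [analyticRank_smul] at h
    exact h.trans h1₀
  have hisod : IsIsogenous Wd Wd₀ :=
    ((isIsogenous_of_smul_eq hC).trans' hisoT).trans' (isIsogenous_of_smul_eq' hC₀)
  have hbsd₀ : BSDp Wd₀ p :=
    X2.bsdp_of_isIsogenous_of_bsdp hCassels hGZK hE Wd Wd₀ hisod p (le_of_eq hrd) hbsd
  haveI : Finite Wd₀.sha := (hGZK Wd₀ (le_of_eq hrd₀)).2
  have hUd₀ : MissingUpperBoundAt Wd₀ p :=
    (lower_and_upper_of_missingPPartAt Wd₀ p (missingPPartAt_of_bsdp Wd₀ p hbsd₀)).2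
  ---------------------------------------------------------------- p625263 §2 at `W₀`
  have hMC₀ : X2.MazurMainConjectureAt W₀ p :=
    mazurMainConjectureAt_of_indexLowerBoundAt_of_upper_twist hWu hJs hJn hHs hHn hGZK hE W₀ p (hGS W₀ p)
      (W₀.conductorNorm ℤ) K Dt H ι P (hGZ _ W₀ K) (hKo _ W₀ K) hK hoddK hlt rfl hHN₀ hHp hPt hcM hp2
      hmult₀ hred₀ hr₀ Wd₀ ⟨C₀, hC₀⟩ hrd₀
      (hSL0 W₀ p (W₀.conductorNorm ℤ) K Dt H ι P hp2 hmult₀ hred₀ hr₀ rfl hK hoddK hlt hHN₀ h1₀ hPt hcM) hUd₀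
  ---------------------------------------------------------------- `BSDp W₀ p`, Cassels to `W`
  have hbsdW₀ : BSDp W₀ p :=
    X2.bsdp_of_mazurMainConjectureAt_of_analyticRank_eq_zero hJs hJn hHs hHn hGZK hE hpar W₀ p (hGS W₀ p)
      hp2 hmult₀ hr₀ hMC₀
  exact X2.bsdp_of_isIsogenous_of_bsdp hCassels hGZK hE W₀ W hiso.symm_of_charZero p (by rw [hr₀]; omega)
    hbsdW₀

/-- **PER PAIR: Mazur's main conjecture `X2.MazurMainConjectureAt W p` at an X2b pair from a TWO-STEP UNIT datum** —
`bsdp_of_cellB_of_twoStepShaUnit` and the exact converse at an odd multiplicative reducible rank-`0` pair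
(`X2.mazurMainConjectureAt_of_bsdp_of_red`: Wuthrich Thm. 16 + Stein–Wuthrich + Greenberg–Stevens + GZK). CONDITIONAL.
[claim: KellerYin2024, status: under-review] [cite: KellerYin2024, Thm. D = Thm. 5.1.3 (arXiv:2402.12781v2 L306–L309)]
[cite: Wuthrich2014, Thm. 16 and §5 (p. 397)] [cite: GreenbergLNM1716, §4 (PDF pp. 112–113)] [cite: Miller2011LMS, Def. 1.1] -/
theorem mazurMainConjectureAt_of_cellB_of_twoStepShaUnit (hP : EisensteinPrimes.PublishedInputs) (hW21 : sha_dvd_analyticSha)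
    (hPT : ∀ (K : Type) [Field K] [NumberField K], poitouTate_selmerStructure_duality K)
    (hPT2 : ∀ (K : Type) [Field K] [NumberField K], poitouTate_sha_tateDual K)
    (hH : hsieh2014_exists_anticyclotomicPAdicLFunction)
    (hF : LiuZhangZhang2018.thm151_thm153_modularCurve_heegnerVector) (hMaz : mazur_not_dvd_maninConstant_of_odd)
    (hD : KellerYin2024.thmD_imcMult_exists_isBDPLFunction_isTorsion_charIdeal_eq_OPEN)
    (W : WeierstrassCurve ℚ) [W.IsElliptic] [W.IsGloballyMinimal] (p : ℕ) [Fact p.Prime] (hc : X2.CellB W p)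
    (K : Type) [Field K] [NumberField K] (hK : IsImaginaryQuadratic K)
    (hHN : SatisfiesHeegnerHypothesis (W.conductorNorm ℤ) K) (hHp : SatisfiesHeegnerHypothesis p K)
    (hoddK : Odd (NumberField.discr K)) (hlt : NumberField.discr K < -4)
    (hr1 : (W.quadraticTwist (NumberField.discr K : ℚ)).analyticRank = 1)
    (Wd : WeierstrassCurve ℚ) [Wd.IsElliptic] [Wd.IsGloballyMinimal]
    (hWd : ∃ C : VariableChange ℚ, C • Wd = W.quadraticTwist (NumberField.discr K : ℚ))
    (K'' : Type) [Field K''] [NumberField K''] (hK'' : IsImaginaryQuadratic K'')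
    (hodd'' : Odd (NumberField.discr K'')) (hlt'' : NumberField.discr K'' < -4)
    (hHN'' : SatisfiesHeegnerHypothesis (Wd.conductorNorm ℤ) K'') (hHp'' : SatisfiesHeegnerHypothesis p K'')
    (hL'' : (Wd.quadraticTwist (NumberField.discr K'' : ℚ)).entireLFunction 1 ≠ 0)
    (W'' : WeierstrassCurve ℚ) [W''.IsElliptic] [W''.IsGloballyMinimal]
    (hW'' : ∃ C : VariableChange ℚ, C • W'' = Wd.quadraticTwist (NumberField.discr K'' : ℚ))
    (hunit : ∃ q : ℚ, shaAn W'' = (q : ℂ) ∧ padicValRat p q = 0) : X2.MazurMainConjectureAt W p := by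
  have hnf := hP.2.2.2.2.2.1
  have hGZK := hP.2.2.2.2.2.2.2.2.2.2.1
  have hWu := hP.2.2.2.2.2.2.2.2.2.2.2.2.2.2.1
  have hJs := hP.2.2.2.2.2.2.2.2.2.2.2.2.2.2.2.1
  have hJn := hP.2.2.2.2.2.2.2.2.2.2.2.2.2.2.2.2.1
  have hHs := hP.2.2.2.2.2.2.2.2.2.2.2.2.2.2.2.2.2.1
  have hHn := hP.2.2.2.2.2.2.2.2.2.2.2.2.2.2.2.2.2.2.1
  have hGS := hP.2.2.2.2.2.2.2.2.2.2.2.2.2.2.2.2.2.2.2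
  have hE : WeierstrassCurve.hasEntireLFunction_rat :=
    WeierstrassCurve.hasEntireLFunction_rat_of_exists_isNewformOf hnf
  exact X2.mazurMainConjectureAt_of_bsdp_of_red hWu hJs hJn hHs hHn hGZK hE W p (hGS W p) hc.2.1.1 hc.2.1.2.2
    hc.2.1.2.1 hc.1
    (bsdp_of_cellB_of_twoStepShaUnit hP hW21 hPT hPT2 hH hF hMaz hD W p hc K hK hHN hHp hoddK hlt hr1 Wd hWd K''
      hK'' hodd'' hlt'' hHN'' hHp'' hL'' W'' hW'' hunit)

end Summit.BirchSwinnertonDyer.BirchSwinnertonDyer.Theorems.EisensteinPrimesMazurMCOnCellBTwistbackTwoStepShaUnit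

end
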